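import Literature.NumberTheory.EllipticCurves.Sprung2012.ColemanOrbitLayerTwoProofs
import Literature.NumberTheory.EllipticCurves.Sprung2012.ColemanMapJointInjectiveProofs
import HarnessLib

/-!
# Sprung 2012 Thm. 2.2 / Cor. 2.10 (saturation clause): the «second generator» of the layer-`2` functionals —
# `(T^k • z₀)|_{E(K_2·K_v)} = p·y` for `k ≥ p² − p + 1` (proofs only; roadmap step (R2b))

Topic `Literature/NumberTheory/EllipticCurves`, cluster `Sprung2012` (namespace = path). A THEOREMS file (no definition, no named
fact; net Literature debt `0`). Cell `bsd-ssimc`, width seat `cruxlead-stmt-BirchSwinnertonDyer-19875-w2` (gen 8), `--supports`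
stmt-BirchSwinnertonDyer-22569. Second step towards the hypothesis of `exists_linearMap_isColemanPair_cokernel_of_indep_rat`
(`p²` layer functionals independent mod `p`): after the `p² − p + 1` functionals `(T^t • z₀)|₂` of `ColemanOrbitLayerTwoModPProofs`,
the remaining `p − 1` are the `y_i` with `p·y_i = (T^{p²−p+1+i} • z₀)|₂`, whose EXISTENCE is proved here from the SATURATION and
INJECTIVITY clauses of the tree's `IsHondaSystem` (F. E. I. Sprung, *Iwasawa theory for elliptic curves at supersingular primes: A
pair of main conjectures*, J. Number Theory **132** (2012) [Sprung2012], Thm. 2.2 / Cor. 2.10, dual form: the pairing vector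
`(P_{2,c_2}, P_{2,c_1})` on layer-`2` functionals is injective with `p`-saturated image).

* §0 three elements of `Λ`: `Φ_{p²}(1+T) = T^{p²−p} + p·G₂` (`exists_cyclotomic_sq_comp_eq_X_pow_add`), `ω_1 = T^p + p·E₁`
  (`exists_cyclotomicOmega_one_eq_X_pow_add`), `Φ_{p²}(1+T) = p + Φ_p(1+T)·R₄` (`exists_cyclotomic_sq_comp_eq_natCast_add`;
  `Φ_p(X) ∣ Φ_{p²}(X) − p = ∑_{i<p}(X^{pi} − 1)`).
* §1 **`exists_layer_functional_mul_eq_lambdaSMul_X_pow`** — for `z₀` with a Coleman value `(α, β)` and `k ≥ p² − p + 1` there is a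
  layer functional `y` with `(T^k • z₀)(x) = p·y(x)` on `E(K_2·K_v)`. The pairing vector of `(T^k•z₀)|₂` is
  `(ω_2Q − a_pT^kα + Φ_p(1+T)T^kβ, Φ_{p²}(1+T)(ω_1Q′ − T^kα))` (levels `2`, `1` of Def. 5.9 and level raising
  `P_{2,c_1} = Φ_{p²}(1+T)·P_{1,c_1}`), which is `p·(a, b) (mod ω_2)` for the explicit
  `a = −(a′T^kα + T^{k−k₀}G₂ω_1β)`, `b = −T^{k−k₀+1}αΦ_{p²}(1+T)(1 − G₂)` (`a_p = pa′`, `k₀ = p²−p+1`; identities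
  `T^{k₀}Φ_p(1+T) = T^{k−k₀}(ω_2 − pG₂ω_1)` and `TΦ_{p²}² = pTΦ_{p²} + ω_2R₄`).
HONEST FRAMING: existence of `y` only; that `y, …` are NEW modulo `p` (independent of the `Λ`-orbit of `z₀`) is step (R2c)
(`Φ_{p²}(1) = p`), not done here. Nothing about any Selmer group, main conjecture or BSD is asserted.

References: [Sprung2012] Thm. 2.2, Lemma 2.3 (p. 1487), Cor. 2.10 (p. 1489), Def. 3.1 (p. 1489), Prop. 5.5, Def. 5.9 (pp. 1494–1495),
Def. 7.1–7.2, Lemmas 7.4–7.5 (p. 1500); [Sprung2017] §4 Cor. 4.4; [Washington1997] §7.1; [Pollack2003] Thm. 6.17; tree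
`Sprung2012/{ColemanOrbitLayerTwoProofs, ColemanMapJointInjectiveProofs (pairingSum_comp_inclusion, coe_thetaPoly), ColemanPairExistsProofs
(thetaPoly_succ_of_mem_layer), ColemanMapLambdaActionProofs (pairingSum_smul), ColemanTwistProofs (pairingSum_sub), LocalIwasawaModule}.lean`.
-/

noncomputable section

open scoped Classical

open Polynomial Finset

namespace Literature.NumberTheory.EllipticCurves.Sprung2012

open Literature.NumberTheory.EllipticCurves Literature.NumberTheory.GaloisRepresentations ZpExtension
  Literature.NumberTheory.EllipticCurves.Kobayashi2003 Literature.NumberTheory.EllipticCurves.Sprung2017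

/-! ## §0 Three elements of `Λ`: `E₁ = (ω_1 − T^p)/p`, `G₂ = (Φ_{p²}(1+T) − T^{p²−p})/p`, `R₄ = (Φ_{p²}(1+T) − p)/Φ_p(1+T)` -/

section Elements

variable {p : ℕ} [Fact p.Prime]

/-- A power series over `ℤ_p` all of whose coefficients are divisible by `p` is `p` times a power series. [folklore] -/
private theorem exists_eq_C_mul_of_forall_dvd_coeff {F : IwasawaAlgebra p}
    (h : ∀ n, (p : ℤ_[p]) ∣ PowerSeries.coeff n F) : ∃ G : IwasawaAlgebra p, F = PowerSeries.C (p : ℤ_[p]) * G := by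
  choose g hg using h
  refine ⟨PowerSeries.mk g, PowerSeries.ext fun n ↦ ?_⟩
  rw [PowerSeries.coeff_C_mul, PowerSeries.coeff_mk, hg n]

/-- A power series over `ℤ_p` vanishing modulo `p` is `p` times a power series. [folklore] -/
private theorem exists_eq_C_mul_of_map_toZMod_eq_zero {F : IwasawaAlgebra p}
    (h : PowerSeries.map (PadicInt.toZMod (p := p)) F = 0) : ∃ G : IwasawaAlgebra p, F = PowerSeries.C (p : ℤ_[p]) * G := by
  refine exists_eq_C_mul_of_forall_dvd_coeff fun n ↦ ?_
  have hn := congrArg (PowerSeries.coeff n) h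
  rw [PowerSeries.coeff_map, map_zero] at hn
  rw [← RingHom.mem_ker, PadicInt.ker_toZMod, PadicInt.maximalIdeal_eq_span_p, Ideal.mem_span_singleton] at hn
  exact hn

/-- Reduction modulo `p` commutes with `ℤ[X] → Λ`. [folklore] -/
private theorem map_toZMod_toIwasawa'' (q : ℤ[X]) :
    PowerSeries.map (PadicInt.toZMod (p := p)) (toIwasawa p q) = ((q.map (Int.castRingHom (ZMod p)) : (ZMod p)[X]) :
      PowerSeries (ZMod p)) := by
  ext n
  rw [PowerSeries.coeff_map, show toIwasawa p q = ((q.map (Int.castRingHom ℤ_[p]) : ℤ_[p][X]) : PowerSeries ℤ_[p]) from rfl,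
    Polynomial.coeff_coe, Polynomial.coeff_coe, Polynomial.coeff_map, Polynomial.coeff_map, eq_intCast, eq_intCast,
    map_intCast]

/-- `ω_n ≡ T^{pⁿ} (mod p)`. [cite: Pollack2003, Thm. 6.17 (ω_n)] -/
private theorem map_toZMod_toIwasawa_cyclotomicOmega'' (n : ℕ) :
    PowerSeries.map (PadicInt.toZMod (p := p)) (toIwasawa p (cyclotomicOmega p n)) = PowerSeries.X ^ p ^ n := by
  rw [map_toZMod_toIwasawa'', cyclotomicOmega, Polynomial.map_sub, Polynomial.map_pow, Polynomial.map_add,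
    Polynomial.map_X, Polynomial.map_one, add_pow_char_pow, one_pow, add_sub_cancel_right, Polynomial.coe_pow,
    Polynomial.coe_X]

/-- `Φ_{p^{k+1}}(1+T) ≡ T^{p^{k+1} − p^k} (mod p)`. [cite: Pollack2003, Thm. 6.17 (ω_n)] -/
private theorem map_toZMod_toIwasawa_cyclotomic_comp'' (k : ℕ) :
    PowerSeries.map (PadicInt.toZMod (p := p)) (toIwasawa p ((cyclotomic (p ^ (k + 1)) ℤ).comp (X + 1))) =
      PowerSeries.X ^ (p ^ (k + 1) - p ^ k) := by
  have hp : p.Prime := Fact.out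
  have h := congrArg (fun q ↦ PowerSeries.map (PadicInt.toZMod (p := p)) (toIwasawa p q)) (cyclotomicOmega_succ p k)
  simp only [map_mul, map_toZMod_toIwasawa_cyclotomicOmega''] at h
  have hle : p ^ k ≤ p ^ (k + 1) := Nat.pow_le_pow_right hp.pos (Nat.le_succ k)
  rw [show (PowerSeries.X : PowerSeries (ZMod p)) ^ p ^ (k + 1) = PowerSeries.X ^ p ^ k * PowerSeries.X ^ (p ^ (k + 1) - p ^ k)
    by rw [← pow_add, Nat.add_sub_cancel' hle]] at h
  exact (mul_left_cancel₀ (pow_ne_zero _ PowerSeries.X_ne_zero) h).symm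

/-- **`G₂`**: `Φ_{p²}(1+T) = T^{p²−p} + p·G₂` in `Λ`. [cite: Washington1997, §7.1] -/
theorem exists_cyclotomic_sq_comp_eq_X_pow_add :
    ∃ G₂ : IwasawaAlgebra p, toIwasawa p ((cyclotomic (p ^ 2) ℤ).comp (X + 1)) =
      PowerSeries.X ^ (p ^ 2 - p) + PowerSeries.C (p : ℤ_[p]) * G₂ := by
  obtain ⟨G, hG⟩ := exists_eq_C_mul_of_map_toZMod_eq_zero (p := p)
    (F := toIwasawa p ((cyclotomic (p ^ 2) ℤ).comp (X + 1)) - PowerSeries.X ^ (p ^ 2 - p)) (by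
      rw [map_sub, show (cyclotomic (p ^ 2) ℤ) = cyclotomic (p ^ (1 + 1)) ℤ by norm_num,
        map_toZMod_toIwasawa_cyclotomic_comp'', map_pow, PowerSeries.map_X, pow_one, show p ^ (1 + 1) = p ^ 2 by norm_num,
        sub_self])
  exact ⟨G, by rw [← hG, add_sub_cancel]⟩

/-- **`E₁`**: `ω_1 = T^p + p·E₁` in `Λ`. [cite: Washington1997, §7.1] -/
theorem exists_cyclotomicOmega_one_eq_X_pow_add :
    ∃ E₁ : IwasawaAlgebra p, toIwasawa p (cyclotomicOmega p 1) = PowerSeries.X ^ p + PowerSeries.C (p : ℤ_[p]) * E₁ := by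
  obtain ⟨G, hG⟩ := exists_eq_C_mul_of_map_toZMod_eq_zero (p := p)
    (F := toIwasawa p (cyclotomicOmega p 1) - PowerSeries.X ^ p) (by
      rw [map_sub, map_toZMod_toIwasawa_cyclotomicOmega'', pow_one, map_pow, PowerSeries.map_X, sub_self])
  exact ⟨G, by rw [← hG, add_sub_cancel]⟩

/-- **`R₄`**: `Φ_{p²}(1+T) = p + Φ_p(1+T)·R₄` in `Λ` (`Φ_p(X) ∣ Φ_{p²}(X) − p` since `Φ_{p²}(X) = ∑_{i<p} X^{pi}` and
`X^p − 1 ∣ X^{pi} − 1`). [folklore] -/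
private theorem exists_cyclotomic_sq_comp_eq_natCast_add :
    ∃ R₄ : IwasawaAlgebra p, toIwasawa p ((cyclotomic (p ^ 2) ℤ).comp (X + 1)) =
      PowerSeries.C (p : ℤ_[p]) + toIwasawa p ((cyclotomic p ℤ).comp (X + 1)) * R₄ := by
  have hp : p.Prime := Fact.out
  -- in `ℤ[X]`: `Φ_p ∣ Φ_{p²} − p`
  have hdvd : (cyclotomic p ℤ) ∣ cyclotomic (p ^ 2) ℤ - C (p : ℤ) := by
    rw [show (cyclotomic (p ^ 2) ℤ) = cyclotomic (p ^ (1 + 1)) ℤ by norm_num, cyclotomic_prime_pow_eq_geom_sum hp, pow_one,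
      show (C (p : ℤ) : ℤ[X]) = ∑ i ∈ range p, (1 : ℤ[X]) by rw [sum_const, card_range, nsmul_eq_mul, mul_one, map_natCast],
      ← sum_sub_distrib]
    refine Finset.dvd_sum fun i _ ↦ ?_
    have h1 : (X : ℤ[X]) ^ p - 1 ∣ (X ^ p) ^ i - 1 := sub_one_dvd_pow_sub_one _ _
    have h2 : cyclotomic p ℤ ∣ (X : ℤ[X]) ^ p - 1 := ⟨X - 1, (cyclotomic_prime_mul_X_sub_one ℤ p).symm⟩
    exact h2.trans h1
  obtain ⟨S, hS⟩ := hdvd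
  refine ⟨toIwasawa p (S.comp (X + 1)), ?_⟩
  have h := congrArg (fun q : ℤ[X] ↦ toIwasawa p (q.comp (X + 1))) hS
  simp only [sub_comp, mul_comp, C_comp, map_sub, map_mul] at h
  rw [show toIwasawa p (C (p : ℤ)) = PowerSeries.C (p : ℤ_[p]) by
    rw [show toIwasawa p (C (p : ℤ)) = (((C (p : ℤ) : ℤ[X]).map (Int.castRingHom ℤ_[p]) : ℤ_[p][X]) : PowerSeries ℤ_[p])
      from rfl, Polynomial.map_C, eq_intCast, Int.cast_natCast, Polynomial.coe_C]] at h
  rw [← h, add_sub_cancel]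

end Elements

/-! ## §1 The second generator: `(T^k • z₀)|_{E(K_2·K_v)}` is divisible by `p` for `k ≥ p² − p + 1` -/

section Local

universe u

variable {K : Type u} [Field K] {p : ℕ} [Fact p.Prime] (κ : ZpExtension K p)
variable {E : Type u} [Field E] [Algebra K E] (ι : AlgebraicClosure K →ₐ[K] AlgebraicClosure E)
variable (W : WeierstrassCurve K)

variable {κ ι W}

/-- **The second generator.** For a Honda system (`p ∣ a_p`), a functional `z₀` on the tower with a Coleman value, and
`k ≥ p² − p + 1`: the restriction of `T^k • z₀` to the layer `E(K_2·K_v)` is `p` times a LAYER functional `y`. PROOF: the pairing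
vector of `(T^k • z₀)|₂` is `≡ T^k·s₀ (mod ω_2)` with `s₀ ≡ (βΦ_p(1+T) − a_pα, −αΦ_{p²}(1+T))` (levels `1, 2` of Def. 5.9 and level
raising), and `T^k·s₀ ∈ p·Λ² + ω_2·Λ²` explicitly (`Φ_{p²}(1+T) = T^{p²−p} + pG₂ = p + Φ_p(1+T)R₄`, `ω_1 = TΦ_p(1+T)`,
`ω_2 = ω_1Φ_{p²}(1+T)`); the SATURATION clause of `IsHondaSystem` then produces `y`, and the injectivity clause identifies
`(T^k • z₀)|₂ = p·y`. This is the functional whose reduction supplies the directions modulo `p` missing from the `Λ`-orbit of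
`z₀` (`ColemanOrbitLayerTwoModPProofs`). [cite: Sprung2012, Thm. 2.2 (p. 1487), Cor. 2.10 (p. 1489), Def. 5.9 (p. 1495), Lemmas 7.4–7.5 (p. 1500)] -/
theorem exists_layer_functional_mul_eq_lambdaSMul_X_pow {ap : ℤ} (hap : (p : ℤ) ∣ ap) {g : Field.absoluteGaloisGroup E}
    (hg : κ.IsTopGenerator (resGalOfEmb ι g)) {cneg : localPoints W E} {c : ℕ → localPoints W E}
    (hH : IsHondaSystem κ ι W ap g cneg c) {z₀ : localTowerPointsOfEmb κ ι W →+ ℤ_[p]} {α β : IwasawaAlgebra p}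
    (h₀ : IsColemanPair κ ι W ap g c z₀ α β) {k : ℕ} (hk : p ^ 2 - p + 1 ≤ k) :
    ∃ y : localLayerPointsOfEmb κ ι W 2 →+ ℤ_[p], ∀ (x : localPoints W E) (hx : x ∈ localLayerPointsOfEmb κ ι W 2),
      lambdaSMul κ ι W hg ((PowerSeries.X : IwasawaAlgebra p) ^ k) z₀
          ⟨x, localLayerPointsOfEmb_le_localTowerPointsOfEmb κ ι W 2 hx⟩ = (p : ℤ_[p]) * y ⟨x, hx⟩ := by
  have hp : p.Prime := Fact.out
  obtain ⟨-, hcn, -, -, -, -, -, hinj, hsat⟩ := hH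
  obtain ⟨d, rfl⟩ : ∃ d, k = p ^ 2 - p + 1 + d := ⟨k - (p ^ 2 - p + 1), by omega⟩
  set m : ℕ := p ^ 2 - p with hm
  obtain ⟨a', rfl⟩ := hap
  -- names for the players
  set Φ₁ : IwasawaAlgebra p := toIwasawa p ((cyclotomic p ℤ).comp (X + 1)) with hΦ₁
  set Φ₂ : IwasawaAlgebra p := toIwasawa p ((cyclotomic (p ^ 2) ℤ).comp (X + 1)) with hΦ₂
  set ω₁ : IwasawaAlgebra p := toIwasawa p (cyclotomicOmega p 1) with hω₁
  set ω₂ : IwasawaAlgebra p := toIwasawa p (cyclotomicOmega p 2) with hω₂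
  have eω₁ : ω₁ = PowerSeries.X * Φ₁ := toIwasawa_cyclotomicOmega_one
  have eω₂ : ω₂ = ω₁ * Φ₂ := by
    rw [hω₂, hω₁, hΦ₂, ← map_mul, show (2 : ℕ) = 1 + 1 from rfl, cyclotomicOmega_succ]
  obtain ⟨G₂, hG₂⟩ := exists_cyclotomic_sq_comp_eq_X_pow_add (p := p)
  obtain ⟨R₄, hR₄⟩ := exists_cyclotomic_sq_comp_eq_natCast_add (p := p)
  rw [← hΦ₂] at hG₂ hR₄
  rw [← hΦ₁] at hR₄
  rw [← hm] at hG₂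
  -- the functional `T^k • z₀` and its Coleman data
  set zk := lambdaSMul κ ι W hg ((PowerSeries.X : IwasawaAlgebra p) ^ (m + 1 + d)) z₀ with hzk
  have hCP := isColemanPair_lambdaSMul hg hcn h₀ ((PowerSeries.X : IwasawaAlgebra p) ^ (m + 1 + d))
  rw [← hzk] at hCP
  obtain ⟨Q, hQ⟩ := hCP 2
  obtain ⟨Q', hQ'⟩ := hCP 1
  rw [sharpPoly_two, flatPoly_two, pow_one, map_neg, ← hΦ₁,
    show toIwasawa p (C (↑p * a')) = PowerSeries.C (p : ℤ_[p]) * PowerSeries.C (a' : ℤ_[p]) by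
      rw [show toIwasawa p (C (↑p * a')) = (((C (↑p * a') : ℤ[X]).map (Int.castRingHom ℤ_[p]) : ℤ_[p][X]) : PowerSeries ℤ_[p])
        from rfl, Polynomial.map_C, eq_intCast, Polynomial.coe_C, Int.cast_mul, Int.cast_natCast, map_mul], ← hω₂] at hQ
  rw [sharpPoly_one, flatPoly_one, map_one, map_zero, one_mul, zero_mul, add_zero, ← hω₁] at hQ'
  -- level raising for `c 1` at level `2`
  have hraise : pairingSum W (localTowerPointsOfEmb κ ι W) g 2 (c 1) zk =
      Φ₂ * pairingSum W (localTowerPointsOfEmb κ ι W) g 1 (c 1) zk := by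
    rw [← coe_thetaPoly, ← coe_thetaPoly, show (2 : ℕ) = 1 + 1 from rfl, thetaPoly_succ_of_mem_layer κ ι W hg (hcn 1) zk,
      Polynomial.coe_mul]
    rfl
  -- the restriction to the layer and its pairing sums
  set r : localLayerPointsOfEmb κ ι W 2 →+ ℤ_[p] :=
    zk.comp (AddSubgroup.inclusion (localLayerPointsOfEmb_le_localTowerPointsOfEmb κ ι W 2)) with hr
  have hc1 : c 1 ∈ localLayerPointsOfEmb κ ι W 2 := localLayerPointsOfEmb_mono κ ι W (by norm_num : 1 ≤ 2) (hcn 1)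
  have hP2 : pairingSum W (localLayerPointsOfEmb κ ι W 2) g 2 (c 2) r =
      ω₂ * Q - (PowerSeries.C (p : ℤ_[p]) * PowerSeries.C (a' : ℤ_[p]) * (PowerSeries.X ^ (m + 1 + d) * α) +
        -Φ₁ * (PowerSeries.X ^ (m + 1 + d) * β)) := by
    rw [hr, pairingSum_comp_inclusion κ ι W 2 (hcn 2), ← hQ, add_sub_cancel_right]
  have hP1 : pairingSum W (localLayerPointsOfEmb κ ι W 2) g 2 (c 1) r =
      Φ₂ * (ω₁ * Q' - PowerSeries.X ^ (m + 1 + d) * α) := by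
    rw [hr, pairingSum_comp_inclusion κ ι W 2 hc1, hraise, ← hQ', add_sub_cancel_right]
  -- the explicit quotients by `p`
  set a : IwasawaAlgebra p := -(PowerSeries.C (a' : ℤ_[p]) * PowerSeries.X ^ (m + 1 + d) * α + PowerSeries.X ^ d * G₂ * ω₁ * β)
    with ha
  set b : IwasawaAlgebra p := -(PowerSeries.X ^ (d + 1) * α * Φ₂ * (1 - G₂)) with hb
  have hda : ω₂ ∣ PowerSeries.C (p : ℤ_[p]) * a - pairingSum W (localLayerPointsOfEmb κ ι W 2) g 2 (c 2) r := by
    refine ⟨-(Q + PowerSeries.X ^ d * β), ?_⟩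
    rw [hP2, ha, eω₂, eω₁]
    linear_combination (PowerSeries.X ^ d * β * (PowerSeries.X * Φ₁)) * hG₂
  have hdb : ω₂ ∣ PowerSeries.C (p : ℤ_[p]) * b - pairingSum W (localLayerPointsOfEmb κ ι W 2) g 2 (c 1) r := by
    refine ⟨-(Q' - PowerSeries.X ^ d * α * R₄), ?_⟩
    rw [hP1, hb, eω₂, eω₁]
    linear_combination (Φ₂ * PowerSeries.X ^ (d + 1) * α) * (hG₂.symm.trans hR₄)
  -- saturation, then injectivity
  obtain ⟨y, hya, hyb⟩ := hsat 2 (by norm_num) a b ⟨r, hda, hdb⟩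
  have hzero : r - (p : ℤ_[p]) • y = 0 := by
    refine hinj 2 (by norm_num) _ ?_ ?_
    · rw [pairingSum_sub, pairingSum_smul]
      obtain ⟨Wa, hWa⟩ := hda
      have e : pairingSum W (localLayerPointsOfEmb κ ι W 2) g 2 (c 2) r -
          PowerSeries.C (p : ℤ_[p]) * pairingSum W (localLayerPointsOfEmb κ ι W 2) g 2 (c 2) y =
          PowerSeries.C (p : ℤ_[p]) * (a - pairingSum W (localLayerPointsOfEmb κ ι W 2) g 2 (c 2) y) - ω₂ * Wa := by
        rw [← hWa]; ring
      rw [e]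
      exact dvd_sub (dvd_mul_of_dvd_right hya _) (dvd_mul_right _ _)
    · rw [pairingSum_sub, pairingSum_smul]
      obtain ⟨Wb, hWb⟩ := hdb
      have e : pairingSum W (localLayerPointsOfEmb κ ι W 2) g 2 (c 1) r -
          PowerSeries.C (p : ℤ_[p]) * pairingSum W (localLayerPointsOfEmb κ ι W 2) g 2 (c 1) y =
          PowerSeries.C (p : ℤ_[p]) * (b - pairingSum W (localLayerPointsOfEmb κ ι W 2) g 2 (c 1) y) - ω₂ * Wb := by
        rw [← hWb]; ring
      rw [e]
      exact dvd_sub (dvd_mul_of_dvd_right hyb _) (dvd_mul_right _ _)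
  refine ⟨y, fun x hx ↦ ?_⟩
  have h := congrArg (fun F : localLayerPointsOfEmb κ ι W 2 →+ ℤ_[p] ↦ F ⟨x, hx⟩) hzero
  simp only [AddMonoidHom.sub_apply, AddMonoidHom.smul_apply, smul_eq_mul, AddMonoidHom.zero_apply, sub_eq_zero] at h
  rw [← h, hr, AddMonoidHom.comp_apply]
  rfl

end Local

end Literature.NumberTheory.EllipticCurves.Sprung2012

end
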